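import Summits.AtomisticToContinuum.HydrodynamicLimit.Theorems.CollisionIsometryCLTAdaptedWeightCLTBlockHDissipation
import Summits.AtomisticToContinuum.HydrodynamicLimit.Theorems.CollisionIsometryCLTAdaptedWeightCLTSAScaleSplit
import Summits.AtomisticToContinuum.HydrodynamicLimit.Theorems.CollisionIsometryCLTAdaptedWeightCLTSACellUI

/-!
# Stub `stub_coarsening` (S6) of the line `block-h-dissipation-closure` for the crux `AdaptedWeightCLT`
(stmt-AtomisticToContinuum-14868, rev-12 TIME-LOCAL form; `--supports`), helper file: THE GERMANO SPLIT OF ONE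
BLOCK MOMENT (pure algebra + Cauchy–Schwarz, every configuration)

The particle-level GERMANO DECOMPOSITION of a block moment of the crux (block kernel `φ`, centre `x`, weights
`aᵢ = φ_N(xᵢ − x)`, block velocity `ū = ū_φ(x)`) through a CELL kernel family `ψ` (weights
`bᵢ(x') = ψ_N(xᵢ − x')`, cell velocities `c(x') = ū_ψ(x')`, unit mass `∫ bᵢ(x') dx' = 1`):

  `blkC r φ x C = (N+1)⁻¹ Σᵢ aᵢ p(vᵢ − ū) = ∫ dx' (N+1)⁻¹ Σᵢ aᵢ bᵢ(x') p((vᵢ − c(x')) + (c(x') − ū))`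
  `= ∫ φ_N(x' − x) · blkC r ψ x' C dx'`                       (the CELL TERM, block average of cell moments)
  `+ ∫ (N+1)⁻¹ Σᵢ (aᵢ − φ_N(x' − x)) bᵢ(x') p(vᵢ − c(x')) dx'`  (the KERNEL-VARIATION error)
  `+ ∫ (N+1)⁻¹ Σᵢ aᵢ bᵢ(x') (p(vᵢ − ū) − p(vᵢ − c(x'))) dx'`    (the REYNOLDS terms: each carries a factor `c(x') − ū`)

(`blkC_eq_three`), and the three bounds that make it usable (`blkC_sq_le`):
* CELL TERM — Jensen against the probability density `φ_N(· − x)`: `J² ≤ ∫ φ_N(x' − x) blkC r ψ x' C ² dx'`;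
* KERNEL VARIATION — `|aᵢ − φ_N(x' − x)| bᵢ(x') ≤ ε_N 𝟙[d(xᵢ, x) < R_N] bᵢ(x')` with
  `ε_N = √3 C (N+1)^{4γ} (N+1)^{-γc}` (mean value inequality on `𝕋³`, cell support radius `(N+1)^{-γc}`) and
  `R_N = (N+1)^{-γ} + (N+1)^{-γc}` (`abs_wgtC_sub_mul_le`); then Cauchy–Schwarz in the particle index using only
  `(N+1)⁻¹ #{particles} ≤ 1` (NO hard-core density cap);
* REYNOLDS — the Lipschitz bounds of the two test pairings (`Pointwise.abs_pairT_C2_sub_le`, `…C3…`) and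
  Cauchy–Schwarz over `dx' ⊗ Σᵢ` with the weights `aᵢ bᵢ(x')` (an AM–GM family, `sq_le_mul_of_forall`) bound
  them by `ethG · reyG`, the ψ-SMEARED twins of the scale-split functionals `ethC · reyC` of the line
  `sustained-anisotropy-superexp` (`…SAScaleSplitPointwise.lean`: there the cell velocity of particle `i` is
  sampled AT `xᵢ`, `cvel`; here it is averaged over the cells containing `i`, `∫ ψ_N(xᵢ − x') (…ū_ψ(x')…) dx'`).

All integrals over the cell centre `x'` are honest: every integrand is a continuous expression of `x'` and
of the cell velocity `ū_ψ(x')`, which is measurable and bounded (`integrable_comp_ubarC`).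
-/

namespace Summit.AtomisticToContinuum.HydrodynamicLimit.Theorems.BlockHDissipation

open scoped BigOperators Topology Classical MeasureTheory ENNReal InnerProductSpace
open Filter Set MeasureTheory
open Literature.Analysis.FluidPDE Literature.Analysis.FluidPDE.Torus
open Summit.AtomisticToContinuum.HydrodynamicLimit.Theorems.ContactSourceDuhamel
open Summit.AtomisticToContinuum.HydrodynamicLimit.Theorems.ContactSourceDuhamel.TimeLocal
open Summit.AtomisticToContinuum.HydrodynamicLimit.Theorems.ContactBalance
open Literature.MathematicalPhysics.KineticTheory (hsDiameter localGibbsLaw empiricalDensityField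
  empiricalMomentumField)

noncomputable section

/-! ## §1 The ψ-smeared sub-block Reynolds functionals -/

/-- ψ-SMEARED ENERGY WEIGHT of the Germano split at `x`: block average over particles `i` (weights
`φ_N(xᵢ − x)`) of the `ψ`-average over the cells `x'` containing `i` (weights `ψ_N(xᵢ − x')`, unit mass) of
`1 + |vᵢ − ū_ψ(x')|² + |vᵢ − ū_ψ(x')|⁴ + |ū_ψ(x') − ū_φ(x)|²` (the smeared twin of `SustainedAnisotropy.ethC`). -/
def ethG (N : ℕ) (φ ψ : ℕ → T3 → ℝ) (w : Cfg N) (x : T3) : ℝ :=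
  ∫ x', ((N + 1 : ℕ) : ℝ)⁻¹ * ∑ i : Fin (N + 1), wgtC N φ w x i * (wgtC N ψ w x' i *
    (1 + ‖(w i).2 - ubarC N ψ w x'‖ ^ 2 + ‖(w i).2 - ubarC N ψ w x'‖ ^ 4 +
      ‖ubarC N ψ w x' - ubarC N φ w x‖ ^ 2))

/-- ψ-SMEARED SUB-BLOCK REYNOLDS FLUCTUATION at `x`: block average over particles `i` of the `ψ`-average over
the cells `x'` containing `i` of `|ū_ψ(x') − ū_φ(x)|² + |ū_ψ(x') − ū_φ(x)|⁴` (the smeared twin of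
`SustainedAnisotropy.reyC`). Vanishes iff the cell-velocity field is constant, equal to the block velocity, on
the cells meeting the block's particles; thermal size `≍ θ/m_cell`, `m_cell = (N+1)^{1−3γc} → ∞`. -/
def reyG (N : ℕ) (φ ψ : ℕ → T3 → ℝ) (w : Cfg N) (x : T3) : ℝ :=
  ∫ x', ((N + 1 : ℕ) : ℝ)⁻¹ * ∑ i : Fin (N + 1), wgtC N φ w x i * (wgtC N ψ w x' i *
    (‖ubarC N ψ w x' - ubarC N φ w x‖ ^ 2 + ‖ubarC N ψ w x' - ubarC N φ w x‖ ^ 4))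

namespace Coarsening

/-! ## §2 Scalar bookkeeping -/

/-- AM–GM family ⇒ Cauchy–Schwarz: `M ≤ (t/2) F + (1/2t) G` for all `t > 0` (`M, F, G ≥ 0`) gives `M² ≤ F G`. -/
theorem sq_le_mul_of_forall {M F G : ℝ} (hM : 0 ≤ M) (hF : 0 ≤ F) (hG : 0 ≤ G)
    (h : ∀ t : ℝ, 0 < t → M ≤ t / 2 * F + t⁻¹ / 2 * G) : M ^ 2 ≤ F * G := by
  by_contra hlt
  rw [not_le] at hlt
  have hMpos : 0 < M := by
    rcases hM.eq_or_lt with h0 | h0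
    · rw [← h0] at hlt; nlinarith
    · exact h0
  rcases hF.eq_or_lt with hF0 | hFpos
  · set t := G / M + 1 with ht_def
    have ht : 0 < t := by positivity
    have h1 := h t ht
    rw [← hF0, mul_zero, zero_add] at h1
    have h2 : t * M ≤ t * (t⁻¹ / 2 * G) := mul_le_mul_of_nonneg_left h1 ht.le
    have e1 : t * (t⁻¹ / 2 * G) = G / 2 := by field_simp
    have e2 : t * M = G + M := by rw [ht_def]; field_simp
    rw [e1, e2] at h2
    linarith
  · have ht : 0 < M / F := div_pos hMpos hFpos
    have h1 := h (M / F) ht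
    have e1 : M / F / 2 * F = M / 2 := by field_simp
    have e2 : (M / F)⁻¹ / 2 * G = F * G / (2 * M) := by field_simp
    rw [e1, e2] at h1
    have h3 : F * G / (2 * M) < M / 2 := by
      rw [div_lt_iff₀ (by positivity)]; nlinarith
    linarith

/-- The AM–GM inequality in the form used under the integral sign: `f g ≤ (t/2) F + (1/2t) G` whenever
`f² ≤ F`, `g² ≤ G`, `t > 0`. -/
theorem mul_le_amgm {f g F G t : ℝ} (hF : f ^ 2 ≤ F) (hG : g ^ 2 ≤ G) (ht : 0 < t) :
    f * g ≤ t / 2 * F + t⁻¹ / 2 * G := by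
  have h1 : f * g ≤ t / 2 * f ^ 2 + t⁻¹ / 2 * g ^ 2 := by
    have key : 0 ≤ t * (f - t⁻¹ * g) ^ 2 := by positivity
    have e : t * (f - t⁻¹ * g) ^ 2 = t * f ^ 2 - 2 * (f * g) + t⁻¹ * g ^ 2 := by
      field_simp
      ring
    rw [e] at key
    linarith
  have h2 : t / 2 * f ^ 2 ≤ t / 2 * F := mul_le_mul_of_nonneg_left hF (by positivity)
  have h3 : t⁻¹ / 2 * g ^ 2 ≤ t⁻¹ / 2 * G := mul_le_mul_of_nonneg_left hG (by positivity)
  linarith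

/-! ## §3 One configuration: cell velocities are measurable and bounded; integrability of smeared integrands -/

section Cfg

variable {N : ℕ} {ψ : ℕ → T3 → ℝ}

/-- A velocity bound of a configuration: `‖vⱼ‖ ≤ Σ_k ‖v_k‖`. -/
theorem norm_vel_le_sum (w : Cfg N) (j : Fin (N + 1)) : ‖(w j).2‖ ≤ ∑ k, ‖(w k).2‖ :=
  Finset.single_le_sum (fun k _ => norm_nonneg (w k).2) (Finset.mem_univ j)

/-- Cell velocities are bounded by any velocity bound (nonnegative weights; junk `0` on empty cells). -/
theorem norm_ubarC_le (hψ0 : ∀ y, 0 ≤ ψ N y) (w : Cfg N) {V : ℝ} (hV : 0 ≤ V) (hv : ∀ j, ‖(w j).2‖ ≤ V)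
    (x' : T3) : ‖ubarC N ψ w x'‖ ≤ V := by
  rw [Pointwise.ubarC_eq]
  exact (Pointwise.avg_smul_eq_and_norm_le Finset.univ (fun j _ => hψ0 _) (fun j _ => hv j) hV).2

/-- The cell velocity is measurable in the cell centre. -/
theorem measurable_ubarC_right (hψc : Continuous (ψ N)) (w : Cfg N) :
    Measurable fun x' : T3 => ubarC N ψ w x' :=
  (EqRung.measurable_ubarC_prod hψc).of_uncurry_left

/-- Compositional continuity of the test pairings `q ↦ ⟨C, (f q)^{⊗r}⟩` (for `fun_prop`). -/
@[fun_prop]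
theorem continuous_pairT_tpow_comp {X : Type*} [TopologicalSpace X] {r : ℕ} (Ct : Tens r) {f : X → V3}
    (hf : Continuous f) : Continuous fun q => pairT Ct (tpow r (f q)) :=
  (EqRung.continuous_pairT_tpow Ct).comp hf

/-- **Integrability workhorse**: a jointly continuous expression of the cell centre `x'` and of the cell velocity
`ū_ψ(x')` is integrable in `x'` (measurable, and bounded because `ū_ψ` stays in a compact ball). -/
theorem integrable_comp_ubarC (hψc : Continuous (ψ N)) (hψ0 : ∀ y, 0 ≤ ψ N y) (w : Cfg N)
    {H : T3 → V3 → ℝ} (hH : Continuous (Function.uncurry H)) :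
    Integrable fun x' => H x' (ubarC N ψ w x') := by
  set V := ∑ k, ‖(w k).2‖
  have hV : 0 ≤ V := Finset.sum_nonneg fun k _ => norm_nonneg _
  have hc : ∀ x', ‖ubarC N ψ w x'‖ ≤ V := norm_ubarC_le hψ0 w hV (norm_vel_le_sum w)
  have hK : IsCompact ((univ : Set T3) ×ˢ Metric.closedBall (0 : V3) V) :=
    isCompact_univ.prod (isCompact_closedBall 0 V)
  obtain ⟨B, hB⟩ := hK.exists_bound_of_continuousOn hH.continuousOn
  refine Integrable.of_bound
    ((hH.measurable.comp (measurable_id.prodMk (measurable_ubarC_right hψc w))).aestronglyMeasurable) B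
    (ae_of_all _ fun x' => ?_)
  exact hB (x', ubarC N ψ w x') ⟨mem_univ _, mem_closedBall_zero_iff.2 (hc x')⟩

/-- Unit mass of the cell weights in the cell centre: `∫ ψ_N(xᵢ − x') dx' = 1`. -/
theorem integral_wgtC_right (hψ1 : ∫ y, ψ N y = 1) (w : Cfg N) (i : Fin (N + 1)) :
    ∫ x', wgtC N ψ w x' i = 1 := by
  unfold wgtC
  rw [PastDamping.integral_comp_sub_left (ψ N)]
  exact hψ1

/-- **Jensen / Cauchy–Schwarz against a unit-mass nonnegative weight** `k` (through the AM–GM family): if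
`∫ k = 1`, `k ≥ 0`, then `(∫ k f)² ≤ ∫ k f²`, for `k f²` and `k` integrable. -/
theorem sq_integral_mul_le {k f : T3 → ℝ} (hk0 : ∀ x', 0 ≤ k x') (hk1 : ∫ x', k x' = 1)
    (hkf2 : Integrable fun x' => k x' * f x' ^ 2) (hk : Integrable k) :
    (∫ x', k x' * f x') ^ 2 ≤ ∫ x', k x' * f x' ^ 2 := by
  set A := ∫ x', k x' * f x' ^ 2 with hA_def
  have hA : 0 ≤ A := integral_nonneg fun x' => mul_nonneg (hk0 x') (sq_nonneg _)
  rw [← sq_abs]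
  have key : ∀ t : ℝ, 0 < t → |∫ x', k x' * f x'| ≤ t / 2 * A + t⁻¹ / 2 * 1 := by
    intro t ht
    have hg : Integrable fun x' => t / 2 * (k x' * f x' ^ 2) + t⁻¹ / 2 * k x' :=
      (hkf2.const_mul _).add (hk.const_mul _)
    calc |∫ x', k x' * f x'| = ‖∫ x', k x' * f x'‖ := (Real.norm_eq_abs _).symm
      _ ≤ ∫ x', (t / 2 * (k x' * f x' ^ 2) + t⁻¹ / 2 * k x') := by
          refine norm_integral_le_of_norm_le hg (ae_of_all _ fun x' => ?_)
          rw [Real.norm_eq_abs, abs_mul, abs_of_nonneg (hk0 x')]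
          have h := mul_le_amgm (le_of_eq (sq_abs (f x'))) (le_refl ((1 : ℝ) ^ 2)) ht
          have h' : |f x'| ≤ t / 2 * f x' ^ 2 + t⁻¹ / 2 := by simpa using h
          have h'' := mul_le_mul_of_nonneg_left h' (hk0 x')
          linarith
      _ = t / 2 * A + t⁻¹ / 2 * 1 := by
          rw [integral_add (hkf2.const_mul _) (hk.const_mul _), integral_const_mul, integral_const_mul, hk1]
  exact (sq_le_mul_of_forall (abs_nonneg _) hA zero_le_one key).trans_eq (mul_one _)

end Cfg

/-! ## §4 The kernel-variation bound -/

section KernelVariation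

variable {N : ℕ} {γ C γc C' : ℝ} {φ ψ : ℕ → T3 → ℝ}

/-- The kernel-variation Lipschitz size `ε_N = √3 · C (N+1)^{4γ} · (N+1)^{-γc}` (gradient bound of the block
kernel times the cell radius). -/
def kvLip (γ C γc : ℝ) (N : ℕ) : ℝ :=
  Real.sqrt 3 * (C * ((N : ℝ) + 1) ^ (4 * γ)) * ((N : ℝ) + 1) ^ (-γc)

/-- The enlarged block radius `R_N = (N+1)^{-γ} + (N+1)^{-γc}` (block radius plus cell radius). -/
def kvRad (γ γc : ℝ) (N : ℕ) : ℝ := ((N : ℝ) + 1) ^ (-γ) + ((N : ℝ) + 1) ^ (-γc)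

/-- `0 ≤ ε_N` for an admissible block family. -/
theorem kvLip_nonneg (hadm : AdmissibleKernel γ C φ) (γc : ℝ) (N : ℕ) : 0 ≤ kvLip γ C γc N := by
  have hC := Pointwise.admissible_C_nonneg hadm
  unfold kvLip
  exact mul_nonneg (mul_nonneg (Real.sqrt_nonneg _) (mul_nonneg hC (Real.rpow_nonneg (by positivity) _)))
    (Real.rpow_nonneg (by positivity) _)

/-- The minimal-image distance is translation invariant: `d(p − x, q − x) = d(p, q)`. -/
theorem euclidDist_sub_sub (p q x : T3) : euclidDist (p - x) (q - x) = euclidDist p q := by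
  rw [euclidDist_eq, euclidDist_eq, sub_sub_sub_cancel_right]

/-- **KERNEL VARIATION**: against the cell weight `ψ_N(xᵢ − x')`, replacing the block weight of particle `i`,
`φ_N(xᵢ − x)`, by the block weight of the cell centre, `φ_N(x' − x)`, costs at most `ε_N`, and nothing unless
`xᵢ` lies within `R_N` of `x`: `|φ_N(xᵢ − x) − φ_N(x' − x)| ψ_N(xᵢ − x') ≤ ε_N 𝟙[d(xᵢ,x) < R_N] ψ_N(xᵢ − x')`. -/
theorem abs_wgtC_sub_mul_le (hadm : AdmissibleKernel γ C φ) (hadmc : AdmissibleKernel γc C' ψ) (w : Cfg N)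
    (x x' : T3) (i : Fin (N + 1)) :
    |wgtC N φ w x i - φ N (x' - x)| * wgtC N ψ w x' i ≤
      kvLip γ C γc N * (if euclidDist (w i).1 x < kvRad γ γc N then 1 else 0) * wgtC N ψ w x' i := by
  have hb0 : 0 ≤ wgtC N ψ w x' i := hadmc.2.1 N _
  by_cases hb : wgtC N ψ w x' i = 0
  · rw [hb, mul_zero, mul_zero]
  -- the particle is within the cell radius of `x'`
  have hnear : euclidDist (w i).1 x' < ((N : ℝ) + 1) ^ (-γc) := by
    by_contra h
    exact hb (hadmc.2.2.2.1 N _ (by rw [PastDamping.euclidDist_sub_zero]; exact not_lt.1 h))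
  -- Lipschitz bound
  have hlip : |wgtC N φ w x i - φ N (x' - x)| ≤ kvLip γ C γc N := by
    have h1 := Torus.abs_sub_le_of_norm_gradient_le (hadm.1 N) (hadm.2.2.2.2.2 N) ((w i).1 - x) (x' - x)
    have hcard : Real.sqrt (Fintype.card (Fin 3)) = Real.sqrt 3 := by norm_num
    rw [hcard] at h1
    refine h1.trans ?_
    unfold kvLip
    refine mul_le_mul_of_nonneg_left ?_ (by have := Pointwise.admissible_C_nonneg hadm; positivity)
    exact ((norm_sub_le_euclidDist_holds _ _).trans_eq (euclidDist_sub_sub _ _ _)).trans hnear.le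
  by_cases hx : euclidDist (w i).1 x < kvRad γ γc N
  · rw [if_pos hx, mul_one]
    exact mul_le_mul_of_nonneg_right hlip hb0
  · -- far particle: both block weights vanish
    rw [not_lt, kvRad] at hx
    have ha : wgtC N φ w x i = 0 := hadm.2.2.2.1 N _ (by
      rw [PastDamping.euclidDist_sub_zero]
      linarith [Real.rpow_nonneg (by positivity : (0 : ℝ) ≤ (N : ℝ) + 1) (-γc)])
    have hk : φ N (x' - x) = 0 := hadm.2.2.2.1 N _ (by
      rw [PastDamping.euclidDist_sub_zero]
      have htri := euclidDist_triangle (w i).1 x' x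
      linarith)
    rw [ha, hk, sub_zero, abs_zero, zero_mul]
    exact mul_nonneg (mul_nonneg (kvLip_nonneg hadm γc N) (by split_ifs <;> norm_num)) hb0

end KernelVariation

/-! ## §5 The Germano split of one block moment -/

section Test

variable {N : ℕ} {γ C γc C' : ℝ} {φ ψ : ℕ → T3 → ℝ} {r : ℕ} (Ct : Tens r)

/-- STEP 1 (unit mass of the cell weights): the block moment as an integral over cell centres,
`blkC r φ x C = ∫ dx' (N+1)⁻¹ Σᵢ aᵢ bᵢ(x') p(vᵢ − ū)`. -/
theorem blkC_eq_integral (hadmc : AdmissibleKernel γc C' ψ) (w : Cfg N) (x : T3) :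
    blkC r N φ w x Ct = ∫ x', ((N + 1 : ℕ) : ℝ)⁻¹ * ∑ i : Fin (N + 1), wgtC N φ w x i *
      (wgtC N ψ w x' i * pairT Ct (tpow r ((w i).2 - ubarC N φ w x))) := by
  have hψc : Continuous (ψ N) := (hadmc.1 N).continuous
  have hint : ∀ i : Fin (N + 1), Integrable fun x' => wgtC N φ w x i *
      (wgtC N ψ w x' i * pairT Ct (tpow r ((w i).2 - ubarC N φ w x))) := fun i =>
    ((PastDamping.integrable_of_continuous_T3 (hψc.comp (continuous_const.sub continuous_id))).mul_const _
      ).const_mul _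
  rw [integral_const_mul, integral_finsetSum _ fun i _ => hint i]
  unfold blkC
  congr 1
  refine Finset.sum_congr rfl fun i _ => ?_
  rw [integral_const_mul, integral_mul_const]
  change _ = _ * ((∫ x', wgtC N ψ w x' i) * _)
  rw [integral_wgtC_right (hadmc.2.2.1 N), one_mul]

/-- STEP 2 (centring at the cell velocities, pointwise in the cell centre): with `vᵢ − ū = (vᵢ − c(x')) + (c(x') − ū)`,
`(N+1)⁻¹ Σᵢ aᵢ bᵢ p(vᵢ − ū) = φ_N(x' − x) blkC r ψ x' C + (N+1)⁻¹ Σᵢ (aᵢ − φ_N(x' − x)) bᵢ p(vᵢ − c)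
 + (N+1)⁻¹ Σᵢ aᵢ bᵢ (p(vᵢ − ū) − p(vᵢ − c))`. -/
theorem integrand_split (w : Cfg N) (x x' : T3) :
    ((N + 1 : ℕ) : ℝ)⁻¹ * ∑ i : Fin (N + 1), wgtC N φ w x i *
        (wgtC N ψ w x' i * pairT Ct (tpow r ((w i).2 - ubarC N φ w x))) =
      φ N (x' - x) * blkC r N ψ w x' Ct +
      ((N + 1 : ℕ) : ℝ)⁻¹ * ∑ i : Fin (N + 1), (wgtC N φ w x i - φ N (x' - x)) *
        (wgtC N ψ w x' i * pairT Ct (tpow r ((w i).2 - ubarC N ψ w x'))) +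
      ((N + 1 : ℕ) : ℝ)⁻¹ * ∑ i : Fin (N + 1), wgtC N φ w x i * (wgtC N ψ w x' i *
        (pairT Ct (tpow r ((w i).2 - ubarC N φ w x)) - pairT Ct (tpow r ((w i).2 - ubarC N ψ w x')))) := by
  unfold blkC
  have e : ∀ i : Fin (N + 1),
      wgtC N φ w x i * (wgtC N ψ w x' i * pairT Ct (tpow r ((w i).2 - ubarC N φ w x))) =
        φ N (x' - x) * (wgtC N ψ w x' i * pairT Ct (tpow r ((w i).2 - ubarC N ψ w x'))) +
        (wgtC N φ w x i - φ N (x' - x)) * (wgtC N ψ w x' i * pairT Ct (tpow r ((w i).2 - ubarC N ψ w x'))) +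
        wgtC N φ w x i * (wgtC N ψ w x' i * (pairT Ct (tpow r ((w i).2 - ubarC N φ w x)) -
          pairT Ct (tpow r ((w i).2 - ubarC N ψ w x')))) := fun i => by ring
  simp_rw [e, Finset.sum_add_distrib, mul_add, ← Finset.mul_sum]
  ring

/-- Integrability of the three integrands of the split, for an abstract continuous test `p`. -/
theorem integrable_split_aux (hφc : Continuous (φ N)) (hψc : Continuous (ψ N)) (hψ0 : ∀ y, 0 ≤ ψ N y)
    {p : V3 → ℝ} (hp : Continuous p) (w : Cfg N) (x : T3) (u : V3) :
    Integrable (fun x' => φ N (x' - x) * (((N + 1 : ℕ) : ℝ)⁻¹ * ∑ i : Fin (N + 1),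
      ψ N ((w i).1 - x') * p ((w i).2 - ubarC N ψ w x'))) ∧
    Integrable (fun x' => ((N + 1 : ℕ) : ℝ)⁻¹ * ∑ i : Fin (N + 1), (φ N ((w i).1 - x) - φ N (x' - x)) *
        (ψ N ((w i).1 - x') * p ((w i).2 - ubarC N ψ w x'))) ∧
    Integrable (fun x' => ((N + 1 : ℕ) : ℝ)⁻¹ * ∑ i : Fin (N + 1), φ N ((w i).1 - x) * (ψ N ((w i).1 - x') *
        (p ((w i).2 - u) - p ((w i).2 - ubarC N ψ w x')))) := by
  refine ⟨?_, ?_, ?_⟩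
  · refine integrable_comp_ubarC hψc hψ0 w (H := fun x' z => φ N (x' - x) *
      (((N + 1 : ℕ) : ℝ)⁻¹ * ∑ i : Fin (N + 1), ψ N ((w i).1 - x') * p ((w i).2 - z))) ?_
    fun_prop
  · refine integrable_comp_ubarC hψc hψ0 w (H := fun x' z => ((N + 1 : ℕ) : ℝ)⁻¹ *
      ∑ i : Fin (N + 1), (φ N ((w i).1 - x) - φ N (x' - x)) * (ψ N ((w i).1 - x') * p ((w i).2 - z))) ?_
    fun_prop
  · refine integrable_comp_ubarC hψc hψ0 w (H := fun x' z => ((N + 1 : ℕ) : ℝ)⁻¹ *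
      ∑ i : Fin (N + 1), φ N ((w i).1 - x) * (ψ N ((w i).1 - x') * (p ((w i).2 - u) - p ((w i).2 - z)))) ?_
    fun_prop

/-- The three integrands of the split are integrable in the cell centre. -/
theorem integrable_split (hadm : AdmissibleKernel γ C φ) (hadmc : AdmissibleKernel γc C' ψ) (w : Cfg N)
    (x : T3) :
    Integrable (fun x' => φ N (x' - x) * blkC r N ψ w x' Ct) ∧
    Integrable (fun x' => ((N + 1 : ℕ) : ℝ)⁻¹ * ∑ i : Fin (N + 1), (wgtC N φ w x i - φ N (x' - x)) *
        (wgtC N ψ w x' i * pairT Ct (tpow r ((w i).2 - ubarC N ψ w x')))) ∧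
    Integrable (fun x' => ((N + 1 : ℕ) : ℝ)⁻¹ * ∑ i : Fin (N + 1), wgtC N φ w x i * (wgtC N ψ w x' i *
        (pairT Ct (tpow r ((w i).2 - ubarC N φ w x)) - pairT Ct (tpow r ((w i).2 - ubarC N ψ w x'))))) :=
  integrable_split_aux (hadm.1 N).continuous (hadmc.1 N).continuous (hadmc.2.1 N)
    (EqRung.continuous_pairT_tpow Ct) w x (ubarC N φ w x)

/-- **THE GERMANO SPLIT** of one block moment: `blkC r φ x C = J + e + T` with the cell term
`J = ∫ φ_N(x' − x) blkC r ψ x' C dx'`, the kernel-variation error `e` and the Reynolds terms `T`. -/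
theorem blkC_eq_three (hadm : AdmissibleKernel γ C φ) (hadmc : AdmissibleKernel γc C' ψ) (w : Cfg N)
    (x : T3) :
    blkC r N φ w x Ct = (∫ x', φ N (x' - x) * blkC r N ψ w x' Ct) +
      (∫ x', ((N + 1 : ℕ) : ℝ)⁻¹ * ∑ i : Fin (N + 1), (wgtC N φ w x i - φ N (x' - x)) *
        (wgtC N ψ w x' i * pairT Ct (tpow r ((w i).2 - ubarC N ψ w x')))) +
      ∫ x', ((N + 1 : ℕ) : ℝ)⁻¹ * ∑ i : Fin (N + 1), wgtC N φ w x i * (wgtC N ψ w x' i *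
        (pairT Ct (tpow r ((w i).2 - ubarC N φ w x)) - pairT Ct (tpow r ((w i).2 - ubarC N ψ w x')))) := by
  obtain ⟨h1, h2, h3⟩ := integrable_split Ct hadm hadmc w x
  have h12 : Integrable fun x' => φ N (x' - x) * blkC r N ψ w x' Ct +
      ((N + 1 : ℕ) : ℝ)⁻¹ * ∑ i : Fin (N + 1), (wgtC N φ w x i - φ N (x' - x)) *
        (wgtC N ψ w x' i * pairT Ct (tpow r ((w i).2 - ubarC N ψ w x'))) := h1.add h2
  rw [blkC_eq_integral Ct hadmc w x, integral_congr_ae (ae_of_all _ fun x' => integrand_split Ct w x x'),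
    integral_add h12 h3, integral_add h1 h2]

end Test

end Coarsening

/-- Registered anchor of this helper file (`--supports stmt-AtomisticToContinuum-14868`): the KERNEL-VARIATION bound
(`Coarsening.abs_wgtC_sub_mul_le`). -/
theorem bhCoarsening_germanoPointwise_anchor : ∀ (N : ℕ) (γ C γc C' : ℝ) (φ ψ : ℕ → T3 → ℝ) (w : Cfg N) (x x' : T3) (i : Fin (N + 1)), AdmissibleKernel γ C φ → AdmissibleKernel γc C' ψ → |wgtC N φ w x i - φ N (x' - x)| * wgtC N ψ w x' i ≤ Coarsening.kvLip γ C γc N * (if euclidDist (w i).1 x < Coarsening.kvRad γ γc N then 1 else 0) * wgtC N ψ w x' i :=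
  fun _ _ _ _ _ _ _ w x x' i hadm hadmc => Coarsening.abs_wgtC_sub_mul_le hadm hadmc w x x' i

end

end Summit.AtomisticToContinuum.HydrodynamicLimit.Theorems.BlockHDissipation
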